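import Summits.HodgeConjecture.CorCM.Census.CyclicCharacterEvenNonrootLaw

/-!
# Cyclic characters, XLI: ARC COORDINATES for every `k` — fibre deviations, `ddist T_a = Σ` over the arc, the step identity, and the sub-balanced region

COR-CM (cell `pub-hodgecm2`), count-neutral kernel combinatorics by the binder seat b09 (gen 44; lane CYCLIC-CHARACTER FIBRE LAW, part XLI — groundwork for the
`d = 0` law at `k ≥ 3`, cf. `HOME/pub-hodgecm2-b09/lean-g44/LOWER-RULE-ROADMAP.md`), on parts I, V and XXXIV BY NAME.  Theorems only (no definition, no `decide`,
no certificate, no named fact, no `sorry`).  HONEST FRAMING: `HC_CM` is NOT proved, here or anywhere in the tree; nothing here is a period or a headline.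

SETTING: `w : G ↠ ℤ/2ᵏ` additive, `w c ≠ 0` (`w c = h := 2ᵏ⁻¹`), `F_j = w⁻¹(j)`, `n = |F_0|`, and for a type `X` its FIBRE DEVIATIONS `x_j = |F_j ∖ X|` (`j ∈ ℤ/2ᵏ`).
* §1 `x_j + x_{j+h} = n` (`card_fib_sdiff_add_half`); every fibre has size `n`.
* §2 **`T_a = ⊔_{i<h} F_{a+i}`** and **`ddist T_a X = Σ_{i<h} x_{a+i}`** (`ddist_arcType_eq_sum`); the STEP IDENTITY `d_{a+1} + 2x_a = d_a + n` (`ddist_arcType_succ`).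
* §3 TELESCOPING: `d_t + 2Σ_{j<t} x_j = d_0 + t·n` (`t ≤ 2ᵏ`, `ddist_arcType_natCast`) and `d_{−t} + t·n = d_0 + 2Σ_{j<t} x_{−(j+1)}` (`ddist_arcType_neg_natCast`).
* §4 **THE SUB-BALANCED REGION** (`n = 2m`): if `x_j ≤ m` for every `j < h` then `T_0` is a nearest arc type (`bpot X = ddist T_0 X`,
  `bpot_eq_ddist_zero_of_subBalanced`), `T_t` (`t ≤ h`) is nearest iff `x_0 = … = x_{t−1} = m` (`ddist_natCast_eq_iff_of_subBalanced`), and `T_{−t}`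
  (`1 ≤ t ≤ h`) iff `x_{h−1} = … = x_{h−t} = m` (`ddist_neg_natCast_eq_iff_of_subBalanced`): the nearest arc types of a sub-balanced type form an INTERVAL of the
  cycle through `T_0`, which starts at `T_0` as soon as `x_{h−1} < m` — the shape the LOWER RULE of part XXXVI needs at every `k`.

## References
* [Pohlmann1968] H. Pohlmann, Algebraic cycles on abelian varieties of complex multiplication type, Ann. of Math. 88 (1968), Thm 1.
-/

namespace Summit.HodgeConjecture.CorCM.Census.CyclicCharacter

open Finset
open Summit.HodgeConjecture.CorCM.Prior.AllgGroup.RfwfAllgGroup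
open Summit.HodgeConjecture.CorCM.Census.BlockParity
open Summit.HodgeConjecture.CorCM.Census.Coinvariant
open Summit.HodgeConjecture.CorCM.Census.TwistGeneration
open Summit.HodgeConjecture.CorCM.Census.BaseBlock

noncomputable section

variable {G : Type*} [Group G] [Fintype G] [DecidableEq G] {k : ℕ} {w : G → ZMod (2 ^ k)} {c : G}

/-! ## §1 The fibres -/

omit [Fintype G] [DecidableEq G] in
/-- `c` moves the fibre `F_j` to `F_{j+h}`. [folklore] -/
theorem apply_cmul_eq_add_half_iff (hw : ∀ P Q : G, w (P * Q) = w P + w Q) (hk : 1 ≤ k) (hc2 : c * c = 1) (hwc : w c ≠ 0) (j : ZMod (2 ^ k)) (s : G) :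
    w (c * s) = j + ((2 ^ (k - 1) : ℕ) : ZMod (2 ^ k)) ↔ w s = j := by
  rw [hw, apply_c hw hk hc2 hwc, add_comm, add_left_inj]

omit [Fintype G] [DecidableEq G] in
/-- `h + h = 0` in `ℤ/2ᵏ`, so `j + h + h = j`. [folklore] -/
theorem add_half_add_half (hk : 1 ≤ k) (j : ZMod (2 ^ k)) :
    j + ((2 ^ (k - 1) : ℕ) : ZMod (2 ^ k)) + ((2 ^ (k - 1) : ℕ) : ZMod (2 ^ k)) = j := by
  rw [add_assoc, half_add_half hk, add_zero]

/-- **`x_j + x_{j+h} = n`** for every `k`. [folklore] -/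
theorem card_fib_sdiff_add_half (hw : ∀ P Q : G, w (P * Q) = w P + w Q) (hk : 1 ≤ k) (hc2 : c * c = 1) (hwc : w c ≠ 0)
    (h1 : ∃ g₁ : G, w g₁ = 1) (X : CMF G c) (j : ZMod (2 ^ k)) :
    ((univ.filter fun s : G => w s = j) \ X.1).card + ((univ.filter fun s : G => w s = j + ((2 ^ (k - 1) : ℕ) : ZMod (2 ^ k))) \ X.1).card =
      (univ.filter fun s : G => w s = 0).card := by
  have himg : (univ.filter fun s : G => w s = j + ((2 ^ (k - 1) : ℕ) : ZMod (2 ^ k))) \ X.1 =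
      ((univ.filter fun s : G => w s = j).filter fun s => s ∈ X.1).image fun s => c * s := by
    ext y
    rw [mem_sdiff, mem_filter, mem_image]
    constructor
    · rintro ⟨⟨-, hy⟩, hyX⟩
      refine ⟨c * y, mem_filter.mpr ⟨mem_filter.mpr ⟨mem_univ _, ?_⟩, ?_⟩, by rw [← mul_assoc, hc2, one_mul]⟩
      · rw [hw, hy, apply_c hw hk hc2 hwc, add_comm ((2 ^ (k - 1) : ℕ) : ZMod (2 ^ k)), add_half_add_half hk]
      · by_contra h; exact hyX (by have := (X.2 (c * y)); rw [← mul_assoc, hc2, one_mul] at this; tauto)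
    · rintro ⟨s, hs, rfl⟩
      rw [mem_filter, mem_filter] at hs
      exact ⟨⟨mem_univ _, (apply_cmul_eq_add_half_iff hw hk hc2 hwc j s).mpr hs.1.2⟩, (X.2 s).mp hs.2⟩
  rw [himg, card_image_of_injective _ (mul_right_injective c), filter_mem_eq_inter, ← card_fib_eq hw h1 j]
  have h := card_sdiff_add_card_inter (univ.filter fun s : G => w s = j) X.1
  omega

/-! ## §2 Arc types as unions of fibres; the distance as a sum; the step identity -/

/-- **`P ∈ T_a ↔ w P = a + i` for some `i < h`.** [folklore] -/
theorem mem_arcType_iff_exists (hw : ∀ P Q : G, w (P * Q) = w P + w Q) (hk : 1 ≤ k) (hc2 : c * c = 1) (hwc : w c ≠ 0) (a : ZMod (2 ^ k)) (P : G) :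
    P ∈ (arcType hw hk hc2 hwc a).1 ↔ ∃ i : ℕ, i < 2 ^ (k - 1) ∧ w P = a + (i : ZMod (2 ^ k)) := by
  haveI : NeZero (2 ^ k) := ⟨pow_ne_zero _ two_ne_zero⟩
  rw [mem_arcType]
  constructor
  · intro h
    exact ⟨(w P - a).val, h, by rw [ZMod.natCast_zmod_val, add_sub_cancel]⟩
  · rintro ⟨i, hi, hP⟩
    have hlt : i < 2 ^ k := lt_of_lt_of_le hi (Nat.pow_le_pow_right (by norm_num) (by omega))
    rw [hP, add_sub_cancel_left, ZMod.val_cast_of_lt hlt]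
    exact hi

omit [Group G] [Fintype G] [DecidableEq G] in
/-- Casting `ℕ → ℤ/2ᵏ` is injective below `2ᵏ⁻¹`. [folklore] -/
theorem natCast_inj_of_lt_half (hk : 1 ≤ k) {i i' : ℕ} (hi : i < 2 ^ (k - 1)) (hi' : i' < 2 ^ (k - 1))
    (h : (i : ZMod (2 ^ k)) = (i' : ZMod (2 ^ k))) : i = i' := by
  have hlt : i < 2 ^ k := lt_of_lt_of_le hi (Nat.pow_le_pow_right (by norm_num) (by omega))
  have hlt' : i' < 2 ^ k := lt_of_lt_of_le hi' (Nat.pow_le_pow_right (by norm_num) (by omega))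
  have := congrArg ZMod.val h
  rwa [ZMod.val_cast_of_lt hlt, ZMod.val_cast_of_lt hlt'] at this

/-- **`T_a ∖ X = ⊔_{i<h} (F_{a+i} ∖ X)`.** [folklore] -/
theorem sdiff_arcType_eq_biUnion (hw : ∀ P Q : G, w (P * Q) = w P + w Q) (hk : 1 ≤ k) (hc2 : c * c = 1) (hwc : w c ≠ 0)
    (a : ZMod (2 ^ k)) (X : CMF G c) :
    (arcType hw hk hc2 hwc a).1 \ X.1 = (range (2 ^ (k - 1))).biUnion fun i => (univ.filter fun s : G => w s = a + (i : ZMod (2 ^ k))) \ X.1 := by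
  ext P
  rw [mem_sdiff, mem_arcType_iff_exists hw hk hc2 hwc, mem_biUnion]
  constructor
  · rintro ⟨⟨i, hi, hP⟩, hPX⟩
    exact ⟨i, mem_range.mpr hi, mem_sdiff.mpr ⟨mem_filter.mpr ⟨mem_univ _, hP⟩, hPX⟩⟩
  · rintro ⟨i, hi, hP⟩
    rw [mem_sdiff, mem_filter] at hP
    exact ⟨⟨i, mem_range.mp hi, hP.1.2⟩, hP.2⟩

/-- **`ddist T_a X = Σ_{i<h} x_{a+i}`.** [folklore] -/
theorem ddist_arcType_eq_sum (hw : ∀ P Q : G, w (P * Q) = w P + w Q) (hk : 1 ≤ k) (hc2 : c * c = 1) (hwc : w c ≠ 0)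
    (a : ZMod (2 ^ k)) (X : CMF G c) :
    ddist (arcType hw hk hc2 hwc a) X = ∑ i ∈ range (2 ^ (k - 1)), ((univ.filter fun s : G => w s = a + (i : ZMod (2 ^ k))) \ X.1).card := by
  unfold ddist
  rw [sdiff_arcType_eq_biUnion hw hk hc2 hwc a X, card_biUnion]
  intro i hi i' hi' hne
  rw [Function.onFun, disjoint_left]
  intro s hs hs'
  have h := (mem_filter.mp (mem_sdiff.mp hs).1).2.symm.trans (mem_filter.mp (mem_sdiff.mp hs').1).2
  exact hne (natCast_inj_of_lt_half hk (mem_range.mp hi) (mem_range.mp hi') (add_left_cancel h))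

/-- **THE STEP IDENTITY `d_{a+1} + x_a = d_a + x_{a+h}`.** [folklore] -/
theorem ddist_arcType_succ_add (hw : ∀ P Q : G, w (P * Q) = w P + w Q) (hk : 1 ≤ k) (hc2 : c * c = 1) (hwc : w c ≠ 0)
    (a : ZMod (2 ^ k)) (X : CMF G c) :
    ddist (arcType hw hk hc2 hwc (a + 1)) X + ((univ.filter fun s : G => w s = a) \ X.1).card =
      ddist (arcType hw hk hc2 hwc a) X + ((univ.filter fun s : G => w s = a + ((2 ^ (k - 1) : ℕ) : ZMod (2 ^ k))) \ X.1).card := by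
  rw [ddist_arcType_eq_sum hw hk hc2 hwc, ddist_arcType_eq_sum hw hk hc2 hwc]
  have h := Finset.sum_range_succ (fun i => ((univ.filter fun s : G => w s = a + (i : ZMod (2 ^ k))) \ X.1).card) (2 ^ (k - 1))
  have h' := Finset.sum_range_succ' (fun i => ((univ.filter fun s : G => w s = a + (i : ZMod (2 ^ k))) \ X.1).card) (2 ^ (k - 1))
  simp only [Nat.cast_zero, add_zero, Nat.cast_succ] at h h'
  have e : ∀ i : ℕ, a + 1 + (i : ZMod (2 ^ k)) = a + ((i : ZMod (2 ^ k)) + 1) := fun i => by ring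
  simp only [e]
  omega

/-- **THE STEP IDENTITY `d_{a+1} + 2x_a = d_a + n`.** [folklore] -/
theorem ddist_arcType_succ (hw : ∀ P Q : G, w (P * Q) = w P + w Q) (hk : 1 ≤ k) (hc2 : c * c = 1) (hwc : w c ≠ 0)
    (h1 : ∃ g₁ : G, w g₁ = 1) (a : ZMod (2 ^ k)) (X : CMF G c) :
    ddist (arcType hw hk hc2 hwc (a + 1)) X + 2 * ((univ.filter fun s : G => w s = a) \ X.1).card =
      ddist (arcType hw hk hc2 hwc a) X + (univ.filter fun s : G => w s = 0).card := by
  have h := ddist_arcType_succ_add hw hk hc2 hwc a X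
  have h' := card_fib_sdiff_add_half hw hk hc2 hwc h1 X a
  omega

/-! ## §3 Telescoping along the cycle -/

/-- **`d_t + 2·Σ_{j<t} x_j = d_0 + t·n`** for every `t : ℕ`. [folklore] -/
theorem ddist_arcType_natCast (hw : ∀ P Q : G, w (P * Q) = w P + w Q) (hk : 1 ≤ k) (hc2 : c * c = 1) (hwc : w c ≠ 0)
    (h1 : ∃ g₁ : G, w g₁ = 1) (X : CMF G c) (t : ℕ) :
    ddist (arcType hw hk hc2 hwc (t : ZMod (2 ^ k))) X + 2 * ∑ j ∈ range t, ((univ.filter fun s : G => w s = (j : ZMod (2 ^ k))) \ X.1).card =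
      ddist (arcType hw hk hc2 hwc 0) X + t * (univ.filter fun s : G => w s = 0).card := by
  induction t with
  | zero => simp
  | succ t ih =>
    have h := ddist_arcType_succ hw hk hc2 hwc h1 (t : ZMod (2 ^ k)) X
    rw [← Nat.cast_add_one] at h
    rw [sum_range_succ, add_one_mul]
    omega

/-- **`d_{−t} + t·n = d_0 + 2·Σ_{j<t} x_{−(j+1)}`** for every `t : ℕ`. [folklore] -/
theorem ddist_arcType_neg_natCast (hw : ∀ P Q : G, w (P * Q) = w P + w Q) (hk : 1 ≤ k) (hc2 : c * c = 1) (hwc : w c ≠ 0)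
    (h1 : ∃ g₁ : G, w g₁ = 1) (X : CMF G c) (t : ℕ) :
    ddist (arcType hw hk hc2 hwc (-(t : ZMod (2 ^ k)))) X + t * (univ.filter fun s : G => w s = 0).card =
      ddist (arcType hw hk hc2 hwc 0) X + 2 * ∑ j ∈ range t, ((univ.filter fun s : G => w s = -((j + 1 : ℕ) : ZMod (2 ^ k))) \ X.1).card := by
  induction t with
  | zero => simp
  | succ t ih =>
    have h := ddist_arcType_succ hw hk hc2 hwc h1 (-((t + 1 : ℕ) : ZMod (2 ^ k))) X
    have e : -((t + 1 : ℕ) : ZMod (2 ^ k)) + 1 = -(t : ZMod (2 ^ k)) := by push_cast; ring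
    rw [e] at h
    rw [sum_range_succ, add_one_mul]
    omega

omit [Group G] [Fintype G] [DecidableEq G] in
/-- Every element of `ℤ/2ᵏ` is `t` with `t ≤ h` or `−t` with `1 ≤ t < h` (`h = 2ᵏ⁻¹`). [folklore] -/
theorem eq_natCast_or_eq_neg_natCast (hk : 1 ≤ k) (a : ZMod (2 ^ k)) :
    (∃ t : ℕ, t ≤ 2 ^ (k - 1) ∧ a = (t : ZMod (2 ^ k))) ∨ (∃ t : ℕ, 1 ≤ t ∧ t < 2 ^ (k - 1) ∧ a = -(t : ZMod (2 ^ k))) := by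
  haveI : NeZero (2 ^ k) := ⟨pow_ne_zero _ two_ne_zero⟩
  have h2k : 2 ^ k = 2 * 2 ^ (k - 1) := by rw [← pow_succ', Nat.sub_add_cancel hk]
  have hv := ZMod.val_lt a
  by_cases h : a.val ≤ 2 ^ (k - 1)
  · exact Or.inl ⟨a.val, h, (ZMod.natCast_zmod_val a).symm⟩
  · refine Or.inr ⟨2 ^ k - a.val, by omega, by omega, ?_⟩
    rw [Nat.cast_sub hv.le, ZMod.natCast_self, zero_sub, neg_neg, ZMod.natCast_zmod_val]

/-! ## §4 The sub-balanced region -/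

omit [Group G] [Fintype G] [DecidableEq G] in
/-- A sum of terms bounded by `m` equals `t·m` iff every term equals `m`. [folklore] -/
theorem sum_eq_mul_iff_of_le {f : ℕ → ℕ} {m t : ℕ} (hf : ∀ j < t, f j ≤ m) :
    ∑ j ∈ range t, f j = t * m ↔ ∀ j < t, f j = m := by
  induction t with
  | zero => simp
  | succ t ih =>
    have hf' : ∀ j < t, f j ≤ m := fun j hj => hf j (by omega)
    have hle : ∑ j ∈ range t, f j ≤ t * m := by
      calc ∑ j ∈ range t, f j ≤ ∑ _j ∈ range t, m := sum_le_sum fun j hj => hf' j (mem_range.mp hj)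
        _ = t * m := by rw [sum_const, card_range, smul_eq_mul]
    have ht := hf t (by omega)
    rw [sum_range_succ, Nat.succ_mul]
    constructor
    · intro h
      have h1 : ∑ j ∈ range t, f j = t * m := by omega
      have h2 : f t = m := by omega
      intro j hj
      rcases Nat.lt_succ_iff_lt_or_eq.mp hj with hj | rfl
      · exact (ih hf').mp h1 j hj
      · exact h2
    · intro h
      rw [(ih hf').mpr fun j hj => h j (by omega), h t (by omega)]

/-- **A SUB-BALANCED TYPE HAS `T_0` AMONG ITS NEAREST ARC TYPES**, and `T_t` (`t ≤ h`) is nearest iff `x_0 = … = x_{t−1} = m`; `T_{−t}` (`1 ≤ t < h`) iff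
`x_{−1} = … = x_{−t} = n − m`, i.e. `x_{h−1} = … = x_{h−t} = m`.  Here «sub-balanced» means `2·x_j ≤ n` for every `j < h`, `n = 2m`. [folklore] -/
theorem bpot_eq_ddist_zero_of_subBalanced (hw : ∀ P Q : G, w (P * Q) = w P + w Q) (hk : 1 ≤ k) (hc2 : c * c = 1) (hwc : w c ≠ 0)
    (h1 : ∃ g₁ : G, w g₁ = 1) {m : ℕ} (hm : 2 * m = (univ.filter fun s : G => w s = 0).card) {X : CMF G c}
    (hX : ∀ j : ℕ, j < 2 ^ (k - 1) → ((univ.filter fun s : G => w s = (j : ZMod (2 ^ k))) \ X.1).card ≤ m) :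
    bpot c (arcType hw hk hc2 hwc 0) X = ddist (arcType hw hk hc2 hwc 0) X ∧
    (∀ t : ℕ, t ≤ 2 ^ (k - 1) → (ddist (arcType hw hk hc2 hwc (t : ZMod (2 ^ k))) X = ddist (arcType hw hk hc2 hwc 0) X ↔
      ∀ j < t, ((univ.filter fun s : G => w s = (j : ZMod (2 ^ k))) \ X.1).card = m)) ∧
    (∀ t : ℕ, t ≤ 2 ^ (k - 1) → (ddist (arcType hw hk hc2 hwc (-(t : ZMod (2 ^ k)))) X = ddist (arcType hw hk hc2 hwc 0) X ↔
      ∀ j < t, ((univ.filter fun s : G => w s = -((j + 1 : ℕ) : ZMod (2 ^ k)) + ((2 ^ (k - 1) : ℕ) : ZMod (2 ^ k))) \ X.1).card = m)) := by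
  -- the complementary coordinates `x_{−(j+1)} = n − x_{h−1−j} ≥ m`
  have hneg : ∀ j : ℕ, j < 2 ^ (k - 1) → ((univ.filter fun s : G => w s = -((j + 1 : ℕ) : ZMod (2 ^ k))) \ X.1).card +
      ((univ.filter fun s : G => w s = -((j + 1 : ℕ) : ZMod (2 ^ k)) + ((2 ^ (k - 1) : ℕ) : ZMod (2 ^ k))) \ X.1).card =
        (univ.filter fun s : G => w s = 0).card := fun j _ => card_fib_sdiff_add_half hw hk hc2 hwc h1 X _
  have hneg' : ∀ j : ℕ, j < 2 ^ (k - 1) →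
      ((univ.filter fun s : G => w s = -((j + 1 : ℕ) : ZMod (2 ^ k)) + ((2 ^ (k - 1) : ℕ) : ZMod (2 ^ k))) \ X.1).card ≤ m := by
    intro j hj
    have e : -((j + 1 : ℕ) : ZMod (2 ^ k)) + ((2 ^ (k - 1) : ℕ) : ZMod (2 ^ k)) = ((2 ^ (k - 1) - 1 - j : ℕ) : ZMod (2 ^ k)) := by
      have h2k : ((2 ^ (k - 1) : ℕ) : ZMod (2 ^ k)) + ((2 ^ (k - 1) : ℕ) : ZMod (2 ^ k)) = 0 := half_add_half hk
      rw [Nat.cast_sub (by omega), Nat.cast_sub (by omega)]; push_cast; ring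
    rw [e]; exact hX _ (by omega)
  -- the telescoping identities
  have hpos := fun t => ddist_arcType_natCast hw hk hc2 hwc h1 X t
  have hnegT := fun t => ddist_arcType_neg_natCast hw hk hc2 hwc h1 X t
  -- `T_0` is nearest
  have hd0 : ∀ a : ZMod (2 ^ k), ddist (arcType hw hk hc2 hwc 0) X ≤ ddist (arcType hw hk hc2 hwc a) X := by
    intro a
    rcases eq_natCast_or_eq_neg_natCast hk a with ⟨t, ht, rfl⟩ | ⟨t, ht1, ht, rfl⟩
    · have h := hpos t
      have hs : ∑ j ∈ range t, ((univ.filter fun s : G => w s = (j : ZMod (2 ^ k))) \ X.1).card ≤ t * m := by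
        calc _ ≤ ∑ _j ∈ range t, m := sum_le_sum fun j hj => hX j (by have := mem_range.mp hj; omega)
          _ = t * m := by rw [sum_const, card_range, smul_eq_mul]
      have : t * (univ.filter fun s : G => w s = 0).card = 2 * (t * m) := by rw [← hm]; ring
      omega
    · have h := hnegT t
      have hs : t * m ≤ ∑ j ∈ range t, ((univ.filter fun s : G => w s = -((j + 1 : ℕ) : ZMod (2 ^ k))) \ X.1).card := by
        calc t * m = ∑ _j ∈ range t, m := by rw [sum_const, card_range, smul_eq_mul]
          _ ≤ _ := sum_le_sum fun j hj => by
              have hj := mem_range.mp hj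
              have := hneg j (by omega); have := hneg' j (by omega); omega
      have : t * (univ.filter fun s : G => w s = 0).card = 2 * (t * m) := by rw [← hm]; ring
      omega
  have hbpot : bpot c (arcType hw hk hc2 hwc 0) X = ddist (arcType hw hk hc2 hwc 0) X := by
    apply le_antisymm
    · have := bpot_le c (arcType hw hk hc2 hwc 0) X 1; rwa [rt_one] at this
    · obtain ⟨Q, hQ⟩ := exists_bpot_eq c (arcType hw hk hc2 hwc 0) X
      rw [hQ, rt_arcType_zero_eq]; exact hd0 _
  refine ⟨hbpot, fun t ht => ?_, fun t ht => ?_⟩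
  · have h := hpos t
    have hmul : t * (univ.filter fun s : G => w s = 0).card = 2 * (t * m) := by rw [← hm]; ring
    rw [← sum_eq_mul_iff_of_le fun j hj => hX j (by omega)]
    omega
  · have h := hnegT t
    have hmul : t * (univ.filter fun s : G => w s = 0).card = 2 * (t * m) := by rw [← hm]; ring
    rw [← sum_eq_mul_iff_of_le fun j hj => hneg' j (by omega)]
    -- `Σ x_{−(j+1)} = t·n − Σ x_{−(j+1)+h}`
    have hsum : ∑ j ∈ range t, ((univ.filter fun s : G => w s = -((j + 1 : ℕ) : ZMod (2 ^ k))) \ X.1).card +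
        ∑ j ∈ range t, ((univ.filter fun s : G => w s = -((j + 1 : ℕ) : ZMod (2 ^ k)) + ((2 ^ (k - 1) : ℕ) : ZMod (2 ^ k))) \ X.1).card =
        t * (univ.filter fun s : G => w s = 0).card := by
      rw [← sum_add_distrib, sum_congr rfl fun j hj => hneg j (by have := mem_range.mp hj; omega), sum_const, card_range, smul_eq_mul]
    omega

end

end Summit.HodgeConjecture.CorCM.Census.CyclicCharacter
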